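import Mathlib.Data.Num.Lemmas
import Literature.Computability.Cryptography.BlumMicaliSampling
import Literature.Computability.Complexity.OracleComputations
import HarnessLib

/-!
# The Blum–Micali reduction as an oracle algorithm, and its success probability

Trunk T-CRYPTO (Literature/Computability/Cryptography); step (d) of the plan for discharging
the named fact `Literature.Computability.Cryptography.blumMicali_halfPredicate_dlog` (`BlumMicali.lean`; Blum–Micali 1984,
Theorem 3), recorded in `BlumMicaliReduction.lean`. This file assembles the pieces proved in
`BlumMicaliReduction.lean` (Lemma 1: the descent; the vote), `BlumMicaliSqrt.lean` (explicit
square roots and Euler's criterion), `BlumMicaliSampling.lean` (Lemma 2 on coin blocks, the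
union bound) and `MajorityVote.lean` (Chebyshev) into

* `bmComp Q z : OracleComp (List Bool)` — the whole probabilistic algorithm of the proof of
  Theorem 3 as an oracle computation (`OracleComputations.lean`) on the machine input
  `z = boolPair x r` (`x = encodeDLogInstance p g y`, `r` the coin string): parse `(p, g, y, r)`;
  with `ℓ = |p|`, `q = Q(|p|)`, `m = 12 ℓ q²` votes of `k + 1 = |p| + |q+1| + 1` coins each,
  segment length `S = ⌊(p-1)/2q⌋ + 1`: for each of the `2q` guesses `i` of the initial segment
  run the `ℓ`-round descent from `w_i = y g^{-iS}` (Euler test, division by `g`, square root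
  `bmSqrt`, majority vote of `m` votes `bmVote` on `x g^r`, `x g^{r+h}` with `r` and the
  tie-coin read from the coin block), obtaining a candidate `c_i + iS`; output (the encoding of)
  the first candidate `c` with `g^c ≡ y`, reduced mod `p - 1`.
  `bmOracleAlg Q = OracleComp.toOracleAlg (bmComp Q)` is the corresponding G01 `OracleAlg`, and
  `bmCoins Q`, `bmFuel Q` its polynomial coin and round budgets.
* `eval_bmComp` — its result, for every oracle, in closed form (`bmIndexOutE` of the selector
  family `bmSelFamily` read off the coin blocks); `queryCount_bmComp_le` — it asks at most
  `48 ℓ² q³` queries.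
* `bmOracleAlg_success` — **the conclusion of Theorem 3 for this algorithm**: for every oracle
  `O`, every instance `(p, g, y)` and every polynomial `Q > 0`, if `O` answers `B_{p,g}`
  correctly on a `1/2 + 1/Q(|p|)` fraction of `ℤ_p^*` then `bmOracleAlg Q` with oracle `O`,
  coins `bmCoins Q` and fuel `bmFuel Q` outputs `index_g(y)` with probability `≥ 2/3`.
* `blumMicali_halfPredicate_dlog_of_isPolyTime` — hence the named fact
  `blumMicali_halfPredicate_dlog` follows from the polynomial-time bound
  `bmOracleAlg_isPolyTime : ∀ Q, (bmOracleAlg Q).IsPolyTime (encodingList Bool)` of its step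
  function, which is vendored here as a named fact (Blum–Micali: "the following probabilistic
  poly(|p|) time algorithm"; its discharge needs a `TM2` program for the step function of
  `bmComp` — the parsing/pairing of the transcript and the modular-arithmetic subroutines —
  assembled with the closure theorems the tree has, `PolyTimeComputable.comp_holds` and
  `PolyTimeComputable.iterate`; the easy direction of Cobham's theorem, carried out in
  `BlumMicaliMachine*.lean`).

Everything is total: on malformed inputs the algorithm computes garbage (no claim is made);
inputs failing the sanity guard `bmGuard` (`p > 2`, `0 < g < p`, `y < p`) are answered by
`encodeNat 0` without any computation — for the one instance off the guard, `p = 2` with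
`g = y = 1`, this is the discrete logarithm. Numbers are parsed by the total map `bitsToNat` of
`BoolEncodings.lean` (binary, least significant digit first), a left inverse of `encodeNat`.

## References

* M. Blum, S. Micali, *How to generate cryptographically strong sequences of pseudo-random
  bits*, SIAM J. Comput. 13 (1984) 850–864, §3.3: Lemma 1 (the descent), Lemma 2 (the vote,
  `trials(ψ, φ)`), Theorem 3 and its proof (guess the initial segment, `n = 2Q(|p|)`,
  `δ = 1/(3|p|)`… , check the candidate by one exponentiation). FOCS 1982 version, Theorem 2,
  pp. 114–116.
* E. Kranakis, *Primality and Cryptography*, Wiley–Teubner 1986, §4.10, Theorems 4.18–4.21.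
* S. Arora, B. Barak, *Computational Complexity*, CUP 2009, §3.4 with Def. 7.1 (probabilistic
  oracle machines: the model behind `OracleAlg.randRun`).
* A. Cobham, *The intrinsic computational difficulty of functions*, in: Logic, Methodology and
  Philosophy of Science II, North-Holland 1965, 24–30 (function algebra for polynomial time).
-/

noncomputable section

namespace Literature.Computability.Cryptography

open Finset _root_.Computability Complexity
open Complexity.OracleComp hiding pure query

/-! ### Binary length of the natural-number encoding

The next three lemmas are private copies: the canonical statement is
`Literature.PQC.length_encodeNat : (encodeNat n).length = n.size` of `ShorClassicalOracle.lean`, whose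
import closure (Shor's assembly) is not wanted here. Refactor note: `length_encodeNat` belongs
upstream in `BoolEncodings.lean`; once it is there these copies go. -/

/-- A positive binary numeral with `L` digits is `< 2^L` (private; canonical:
`Literature.Computability.Cryptography.length_encodeNat`). [folklore] -/
private theorem lt_two_pow_length_encodePosNum (n : PosNum) : (n : ℕ) < 2 ^ (encodePosNum n).length := by
  induction n with
  | one => simp [encodePosNum]
  | bit0 n ih =>
    simp only [encodePosNum, List.length_cons, PosNum.cast_bit0]
    rw [pow_succ]; omega
  | bit1 n ih =>
    simp only [encodePosNum, List.length_cons, PosNum.cast_bit1]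
    rw [pow_succ]; omega

/-- `n < 2^{|encodeNat n|}` (private; canonical: `Literature.Computability.Cryptography.length_encodeNat`). [folklore] -/
private theorem lt_two_pow_length_encodeNat (n : ℕ) : n < 2 ^ (encodeNat n).length := by
  have h : ((n : Num) : ℕ) = n := Num.to_of_nat n
  unfold encodeNat encodeNum
  cases hn : (n : Num) with
  | zero =>
    rw [hn] at h
    rw [← h]
    change (0 : ℕ) < 2 ^ ([] : List Bool).length
    simp
  | pos m =>
    rw [hn, Num.cast_pos] at h
    conv_lhs => rw [← h]
    exact lt_two_pow_length_encodePosNum m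

/-- The binary length `Nat.size n` is at most the length of Mathlib's binary encoding
`encodeNat n` (they are in fact equal: `Literature.Computability.Cryptography.length_encodeNat`, `ShorClassicalOracle.lean`;
private copy). [folklore] -/
private theorem size_le_length_encodeNat (n : ℕ) : n.size ≤ (encodeNat n).length :=
  Nat.size_le.2 (lt_two_pow_length_encodeNat n)

/-- `|p| ≤ |encodeDLogInstance p g y|`. [folklore] -/
theorem size_le_length_encodeDLogInstance (p g y : ℕ) :
    p.size ≤ (encodeDLogInstance p g y).length := by
  refine (size_le_length_encodeNat p).trans ?_
  show (encodeNat p).length ≤ (boolPair (encodeNat p) (boolPair (encodeNat g) (encodeNat y))).length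
  rw [length_boolPair]
  omega

/-- Evaluation of an `ℕ`-polynomial is monotone in the argument (a private copy of
`Literature.Computability.Complexity.TM2Iter.eval_mono`, which is not imported here). [folklore] -/
private theorem natPoly_eval_mono (P : Polynomial ℕ) {x y : ℕ} (hxy : x ≤ y) : P.eval x ≤ P.eval y := by
  induction P using Polynomial.induction_on' with
  | add p q hp hq => simp only [Polynomial.eval_add]; exact Nat.add_le_add hp hq
  | monomial n c =>
    simp only [Polynomial.eval_monomial]
    exact Nat.mul_le_mul_left c (Nat.pow_le_pow_left hxy n)

/-! ### The parameters of the reduction -/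

section Params

variable (Q : Polynomial ℕ) (p : ℕ)

/-- `q = Q(|p|)`: the inverse advantage of the oracle (`ε = 1/Q(|p|)` in Theorem 3).
[Blum–Micali 1984, §3.3, Theorem 3] [cite: BlumMicali1984, Theorem 3] -/
def bmQ : ℕ := Q.eval p.size

/-- `m = 12 |p| q²`: the number of votes per round (Blum–Micali's `trials(ε/4, 1/(3|p|))`, up
to rounding). [Blum–Micali 1984, §3.3, Lemma 2 and proof of Theorem 3] [cite: BlumMicali1984, §3.3 Lemma 2] -/
def bmM : ℕ := 12 * p.size * bmQ Q p ^ 2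

/-- `k = |p| + |q + 1|`: a coin block has `k + 1` bits (`k` for the shift, one tie-coin), so
that `(p-1)(q+1) ≤ 2^k`. [Blum–Micali 1984, §3.3, Lemma 2 (random `r_i`), realised with coins]
[cite: BlumMicali1984, §3.3 Lemma 2 (proof)] -/
def bmK : ℕ := p.size + (bmQ Q p + 1).size

/-- `S = ⌊(p-1)/(2q)⌋ + 1`: the length of the initial segments guessed (`(p-1)/n` with
`n = 2Q(|p|)` in Blum–Micali). [Blum–Micali 1984, §3.3, proof of Theorem 3] [cite: BlumMicali1984, Theorem 3 (proof)] -/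
def bmSeg : ℕ := (p - 1) / (2 * bmQ Q p) + 1

/-- `2q` guesses of the segment containing the index. [Blum–Micali 1984, §3.3, proof of
Theorem 3 (`n = 2Q(|p|)`)] [cite: BlumMicali1984, Theorem 3 (proof)] -/
def bmGuesses : ℕ := 2 * bmQ Q p

variable {Q p}

/-- `(p-1)(q+1) ≤ 2^k`. [folklore] -/
theorem bmK_spec : (p - 1) * (bmQ Q p + 1) ≤ 2 ^ bmK Q p := by
  unfold bmK
  rw [pow_add]
  exact Nat.mul_le_mul (le_of_lt (lt_of_le_of_lt (Nat.sub_le p 1) (Nat.lt_size_self p)))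
    (Nat.lt_size_self _).le

/-- The residue of an index modulo the segment length lies in the initial segment:
`2 (a mod S) q ≤ p - 1`. [Blum–Micali 1984, §3.3, proof of Theorem 3] [cite: BlumMicali1984, Theorem 3 (proof)] -/
theorem two_mul_mod_bmSeg_mul_le (a : ℕ) : 2 * (a % bmSeg Q p) * bmQ Q p ≤ p - 1 := by
  have hS : a % bmSeg Q p ≤ (p - 1) / (2 * bmQ Q p) := by
    have := Nat.mod_lt a (show 0 < bmSeg Q p from Nat.succ_pos _)
    unfold bmSeg at this ⊢
    omega
  calc 2 * (a % bmSeg Q p) * bmQ Q p = 2 * bmQ Q p * (a % bmSeg Q p) := by ring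
    _ ≤ 2 * bmQ Q p * ((p - 1) / (2 * bmQ Q p)) := Nat.mul_le_mul_left _ hS
    _ ≤ p - 1 := Nat.mul_div_le _ _

/-- Every index `a < p - 1` lies in one of the `2q` guessed segments: `a / S < 2q`.
[Blum–Micali 1984, §3.3, proof of Theorem 3] [cite: BlumMicali1984, Theorem 3 (proof)] -/
theorem div_bmSeg_lt {a : ℕ} (ha : a < p - 1) (hq : 1 ≤ bmQ Q p) : a / bmSeg Q p < bmGuesses Q p := by
  have hpos : 0 < 2 * bmQ Q p := by omega
  have h1 : p - 1 < 2 * bmQ Q p * bmSeg Q p := Nat.lt_mul_div_succ (p - 1) hpos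
  rw [Nat.div_lt_iff_lt_mul (show 0 < bmSeg Q p from Nat.succ_pos _)]
  unfold bmGuesses
  calc a < p - 1 := ha
    _ < 2 * bmQ Q p * bmSeg Q p := h1

end Params

/-! ### Reading coin blocks off the coin string -/

section Coins

/-- The position in the coin string of bit `s` of the coin block of vote `j` in round `t` of
guess `i`. [folklore] -/
def bmCoinIdx (ℓ m k i t j s : ℕ) : ℕ :=
  ((i * ℓ + t) * m + j) * (k + 1) + s

/-- The coin table of guess `i`: round `t`, vote `j`, bit `s` ↦ the coin at position
`bmCoinIdx` (junk `false` beyond the string). [Blum–Micali 1984, §3.3 (fresh random choices for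
each vote)] [cite: BlumMicali1984, §3.3 Lemma 2 (proof)] -/
def bmBlocks (r : List Bool) (ℓ m k i : ℕ) : Fin ℓ → Fin m → Fin (k + 1) → Bool :=
  fun t j s => r.getD (bmCoinIdx ℓ m k i t j s) false

/-- Positions of guess `i` are below `(i + 1) ℓ m (k+1)`. [folklore] -/
theorem bmCoinIdx_lt {ℓ m k i t j s : ℕ} (ht : t < ℓ) (hj : j < m) (hs : s < k + 1) :
    bmCoinIdx ℓ m k i t j s < (i + 1) * ℓ * m * (k + 1) := by
  unfold bmCoinIdx
  have h1 : i * ℓ + t < (i + 1) * ℓ := by rw [Nat.succ_mul]; omega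
  have h2 : (i * ℓ + t) * m + j < (i + 1) * ℓ * m := by
    calc (i * ℓ + t) * m + j < (i * ℓ + t) * m + m := by omega
      _ = (i * ℓ + t + 1) * m := by ring
      _ ≤ (i + 1) * ℓ * m := Nat.mul_le_mul_right _ h1
  calc ((i * ℓ + t) * m + j) * (k + 1) + s < ((i * ℓ + t) * m + j) * (k + 1) + (k + 1) := by omega
    _ = ((i * ℓ + t) * m + j + 1) * (k + 1) := by ring
    _ ≤ (i + 1) * ℓ * m * (k + 1) := Nat.mul_le_mul_right _ h2

/-- Uniqueness of quotient and remainder: `A b + u = A' b + u'` with `u, u' < b` forces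
`A = A'`, `u = u'`. [folklore] -/
private theorem mul_add_inj {b A A' u u' : ℕ} (hu : u < b) (hu' : u' < b) (h : A * b + u = A' * b + u') :
    A = A' ∧ u = u' := by
  have hb : 0 < b := lt_of_le_of_lt (Nat.zero_le _) hu
  have h1 : (A * b + u) / b = (A' * b + u') / b := by rw [h]
  have h2 : (A * b + u) % b = (A' * b + u') % b := by rw [h]
  rw [Nat.mul_comm A b, Nat.mul_comm A' b, Nat.mul_add_div hb, Nat.mul_add_div hb,
    Nat.div_eq_of_lt hu, Nat.div_eq_of_lt hu', add_zero, add_zero] at h1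
  rw [Nat.mul_comm A b, Nat.mul_comm A' b, Nat.mul_add_mod, Nat.mul_add_mod, Nat.mod_eq_of_lt hu,
    Nat.mod_eq_of_lt hu'] at h2
  exact ⟨h1, h2⟩

/-- The position map of a fixed guess is injective on `Fin ℓ × Fin m × Fin (k+1)`. [folklore] -/
theorem bmCoinIdx_injective (ℓ m k i : ℕ) :
    Function.Injective fun tjs : Fin ℓ × Fin m × Fin (k + 1) =>
      bmCoinIdx ℓ m k i tjs.1 tjs.2.1 tjs.2.2 := by
  rintro ⟨t, j, s⟩ ⟨t', j', s'⟩ h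
  simp only [bmCoinIdx] at h
  obtain ⟨h2, hs⟩ := mul_add_inj s.2 s'.2 h
  obtain ⟨h3, hj⟩ := mul_add_inj j.2 j'.2 h2
  have ht : (t : ℕ) = t' := by omega
  exact Prod.ext (Fin.ext ht) (Prod.ext (Fin.ext hj) (Fin.ext hs))

end Coins

/-! ### The algorithm as an oracle computation -/

section Algorithm

/-- Query the oracle on the encoded triple `(p, g, z)` and read the answer as the bit
"answer `= encodeBool 1`" (the bit oracle `bmBitOracle`). [Blum–Micali 1984, §3.3, Theorem 3
(a call to the magic box `MB[p, g, ·]`)] [cite: BlumMicali1984, Theorem 3] -/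
def bmAskBit (p g z : ℕ) : OracleComp Bool :=
  OracleComp.bind (ask (encodeDLogInstance p g z)) fun a => OracleComp.pure (decide (a = encodeBool true))

/-- One vote about the candidate square root `x`, with shift `r` and tie-coin `coin`: query the
bits of `x g^r` and `x g^{r+h}`. [Blum–Micali 1984, §3.3, proof of Lemma 2] [cite: BlumMicali1984, §3.3 Lemma 2 (proof)] -/
def bmVoteC (p g x r : ℕ) (coin : Bool) : OracleComp Bool :=
  OracleComp.bind (bmAskBit p g (x * g ^ r % p)) fun b₁ =>
    OracleComp.bind (bmAskBit p g (x * g ^ (r + (p - 1) / 2) % p)) fun b₂ =>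
      OracleComp.pure (if b₁ = b₂ then coin else b₁)

/-- The majority-vote square-root selector run with the coin blocks `blk` (`bmSelect`).
[Blum–Micali 1984, §3.3, Lemma 2] [cite: BlumMicali1984, §3.3 Lemma 2] -/
def bmSelectC (p g m k : ℕ) (blk : Fin m → Fin (k + 1) → Bool) (e : ℕ) : OracleComp ℕ :=
  OracleComp.bind
    (forEach (fun j => bmVoteC p g (bmSqrt p g e) (bmShift p k (blk j)) (bmCoin k (blk j)))
      (List.finRange m))
    fun votes => OracleComp.pure
      (if m < 2 * votes.count true then bmSqrt p g e else bmSqrt p g e * g ^ ((p - 1) / 2) % p)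

/-- One round of the descent (`bmRoundE`) with the majority-vote selector: Euler test, division
by `g`, and (always, to keep the query schedule oblivious) `2m` queries about the square root of
the adjusted residue. [Blum–Micali 1984, §3.3, proof of Lemma 1, Steps 1–3] [cite: BlumMicali1984, §3.3 Lemma 1 (proof)] -/
def bmRoundC (p g m k : ℕ) (blk : Fin m → Fin (k + 1) → Bool) (e : ℕ) : OracleComp (Bool × ℕ) :=
  OracleComp.bind
    (bmSelectC p g m k blk
      ((if !decide (e ^ ((p - 1) / 2) % p = 1) then e * g ^ (p - 2) else e) % p))
    fun s => OracleComp.pure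
      (!decide (e ^ ((p - 1) / 2) % p = 1),
        if (if !decide (e ^ ((p - 1) / 2) % p = 1) then e * g ^ (p - 2) else e) % p = 1 then 1
        else s)

/-- The coin blocks of round `t` in a coin table with `ℓ` rounds (junk beyond `ℓ`). [folklore] -/
def bmBlk (ℓ m k : ℕ) (ω : Fin ℓ → Fin m → Fin (k + 1) → Bool) (t : ℕ) :
    Fin m → Fin (k + 1) → Bool :=
  if h : t < ℓ then ω ⟨t, h⟩ else fun _ _ => false

/-- One step of the descent loop on the state `(t, element, index so far)`.
[Blum–Micali 1984, §3.3, proof of Lemma 1] [cite: BlumMicali1984, §3.3 Lemma 1 (proof)] -/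
def bmDescentStepC (p g ℓ m k : ℕ) (ω : Fin ℓ → Fin m → Fin (k + 1) → Bool) (s : ℕ × ℕ × ℕ) :
    OracleComp (ℕ × ℕ × ℕ) :=
  OracleComp.bind (bmRoundC p g m k (bmBlk ℓ m k ω s.1) s.2.1) fun be =>
    OracleComp.pure (s.1 + 1, be.2, s.2.2 + if be.1 then 2 ^ s.1 else 0)

/-- **The descent** (Blum–Micali's Lemma 1 algorithm) from `w`, `ℓ` rounds, with the
majority-vote selectors read off the coin table `ω`; returns the index found.
[Blum–Micali 1984, §3.3, Lemma 1] [cite: BlumMicali1984, §3.3 Lemma 1] -/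
def bmDescentC (p g ℓ m k : ℕ) (ω : Fin ℓ → Fin m → Fin (k + 1) → Bool) (w : ℕ) :
    OracleComp ℕ :=
  OracleComp.bind (iterM (bmDescentStepC p g ℓ m k ω) ℓ (0, w, 0)) fun s => OracleComp.pure s.2.2

/-- The candidate produced by guess `i`: descend from `w_i = y · g^{-iS}` with the coin table
of guess `i` and shift the result back by `iS`. [Blum–Micali 1984, §3.3, proof of Theorem 3,
Steps 1–2] [cite: BlumMicali1984, Theorem 3 (proof)] -/
def bmCandidateC (Q : Polynomial ℕ) (p g y : ℕ) (r : List Bool) (i : ℕ) : OracleComp ℕ :=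
  OracleComp.bind
    (bmDescentC p g p.size (bmM Q p) (bmK Q p) (bmBlocks r p.size (bmM Q p) (bmK Q p) i)
      (y * (g ^ (p - 2)) ^ (i * bmSeg Q p) % p))
    fun c => OracleComp.pure (c + i * bmSeg Q p)

/-- The output from the list of candidates: the first `c` with `g^c ≡ y (mod p)` (checked by
one exponentiation), reduced mod `p - 1` and encoded in binary; junk `encodeNat 0` if none.
[Blum–Micali 1984, §3.3, proof of Theorem 3, Step 3 ("check whether `g^{index(w)+i(p-1)/n} = y`")]
[cite: BlumMicali1984, Theorem 3 (proof)] -/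
def bmOutput (p g y : ℕ) (cands : List ℕ) : List Bool :=
  encodeNat (((cands.find? fun c => decide (g ^ c % p = y % p)).getD 0) % (p - 1))

/-- The sanity guard on the parsed input: `p > 2`, `0 < g < p`, `y < p`. Every discrete-log
instance with `p ≠ 2` passes it; off the guard the reduction outputs `encodeNat 0 = []` at once
(for the instance `p = 2`, `g = y = 1` this is the discrete logarithm). The guard spares the
machine realisation of the reduction all arithmetic with the moduli `0`, `1`, `2`. [folklore] -/
def bmGuard (p g y : ℕ) : Bool :=
  decide (2 < p) && decide (0 < g) && decide (g < p) && decide (y < p)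

/-- A discrete-log instance with `p ≠ 2` passes the guard. [folklore] -/
theorem bmGuard_of_isDLogInstance {p g y : ℕ} (h : IsDLogInstance p g y) (hp2 : p ≠ 2) :
    bmGuard p g y = true := by
  obtain ⟨hp, hg0, hgp, -, -, hyp⟩ := h
  have := hp.two_le
  simp only [bmGuard, Bool.and_eq_true, decide_eq_true_eq]
  omega

/-- The whole computation on the parsed input `(p, g, y)` and coin string `r` (behind the
guard `bmGuard`). [Blum–Micali 1984, §3.3, proof of Theorem 3] [cite: BlumMicali1984, Theorem 3 (proof)] -/
def bmMainC (Q : Polynomial ℕ) (p g y : ℕ) (r : List Bool) : OracleComp (List Bool) :=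
  if bmGuard p g y then
    OracleComp.bind (forEach (bmCandidateC Q p g y r) (List.range (bmGuesses Q p))) fun cands =>
      OracleComp.pure (bmOutput p g y cands)
  else OracleComp.pure []

/-- **The Blum–Micali reduction as an oracle computation** on the machine input
`z = boolPair (encodeDLogInstance p g y) r`: parse and run `bmMainC`.
[Blum–Micali 1984, §3.3, Theorem 3 (proof)] [cite: BlumMicali1984, Theorem 3 (proof)] -/
def bmComp (Q : Polynomial ℕ) (z : List Bool) : OracleComp (List Bool) :=
  bmMainC Q (bitsToNat (boolUnpair (boolUnpair z).1).1)
    (bitsToNat (boolUnpair (boolUnpair (boolUnpair z).1).2).1)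
    (bitsToNat (boolUnpair (boolUnpair (boolUnpair z).1).2).2) (boolUnpair z).2

/-- The oracle algorithm (G01 `OracleAlg`: transcript step function) of the reduction.
[Blum–Micali 1984, §3.3, Theorem 3] [cite: BlumMicali1984, Theorem 3] -/
def bmOracleAlg (Q : Polynomial ℕ) : OracleAlg (List Bool) :=
  toOracleAlg (bmComp Q)

/-- The coin budget: `24 n² Q(n)³ (n + Q(n) + 2) ≥ 2q · ℓ · m · (k + 1)` coins.
[Blum–Micali 1984, §3.3, proof of Theorem 3] [cite: BlumMicali1984, Theorem 3 (proof)] -/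
def bmCoins (Q : Polynomial ℕ) : Polynomial ℕ :=
  24 * Polynomial.X ^ 2 * Q ^ 3 * (Polynomial.X + Q + 2)

/-- The round budget: `48 n² Q(n)³ + 1 > 2q · ℓ · 2m` queries.
[Blum–Micali 1984, §3.3, proof of Theorem 3] [cite: BlumMicali1984, Theorem 3 (proof)] -/
def bmFuel (Q : Polynomial ℕ) : Polynomial ℕ :=
  48 * Polynomial.X ^ 2 * Q ^ 3 + 1

end Algorithm

/-! ### What the algorithm computes -/

section Eval

variable (O : Oracle)

/-- A bit query evaluates to the bit oracle `bmBitOracle O p g`. [folklore] -/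
@[simp] theorem eval_bmAskBit (p g z : ℕ) : eval O (bmAskBit p g z) = bmBitOracle O p g z := by
  simp [bmAskBit, bmBitOracle]

/-- A bit query is one query. [folklore] -/
@[simp] theorem queryCount_bmAskBit (p g z : ℕ) : queryCount O (bmAskBit p g z) = 1 := by
  simp [bmAskBit]

/-- A vote evaluates to `bmVote`. [Blum–Micali 1984, §3.3 Lemma 2] [cite: BlumMicali1984, §3.3 Lemma 2 (proof)] -/
@[simp] theorem eval_bmVoteC (p g x r : ℕ) (coin : Bool) :
    eval O (bmVoteC p g x r coin) = bmVote p g (bmBitOracle O p g) x r coin := by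
  simp [bmVoteC, bmVote]

/-- A vote asks two queries. [Blum–Micali 1984, §3.3 Lemma 2] [cite: BlumMicali1984, §3.3 Lemma 2 (proof)] -/
@[simp] theorem queryCount_bmVoteC (p g x r : ℕ) (coin : Bool) :
    queryCount O (bmVoteC p g x r coin) = 2 := by
  simp [bmVoteC]

/-- Counting `true` entries of a table over `Fin m`. [folklore] -/
private theorem count_map_finRange {m : ℕ} (P : Fin m → Bool) :
    ((List.finRange m).map P).count true = (univ.filter fun j => P j = true).card := by
  simp [List.count_eq_countP, Fin.univ_def, Finset.card_def, Finset.filter_val,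
    List.countP_eq_length_filter, List.filter_map, Function.comp_def]

/-- The selector computation evaluates to `bmSelect`. [Blum–Micali 1984, §3.3 Lemma 2] [cite: BlumMicali1984, §3.3 Lemma 2] -/
@[simp] theorem eval_bmSelectC (p g m k : ℕ) (blk : Fin m → Fin (k + 1) → Bool) (e : ℕ) :
    eval O (bmSelectC p g m k blk e) = bmSelect p g (bmBitOracle O p g) m k blk e := by
  simp only [bmSelectC, eval_bind, eval_forEach, eval_pure, eval_bmVoteC, bmSelect, bmBlockVote,
    count_map_finRange]

/-- The selector asks `2m` queries. [Blum–Micali 1984, §3.3 Lemma 2] [cite: BlumMicali1984, §3.3 Lemma 2] -/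
@[simp] theorem queryCount_bmSelectC (p g m k : ℕ) (blk : Fin m → Fin (k + 1) → Bool) (e : ℕ) :
    queryCount O (bmSelectC p g m k blk e) = 2 * m := by
  simp only [bmSelectC, queryCount_bind, queryCount_forEach, queryCount_bmVoteC, queryCount_pure,
    List.map_const', List.sum_replicate, List.length_finRange, smul_eq_mul]
  ring

/-- A round evaluates to the explicit round `bmRoundE` with the majority-vote selector.
[Blum–Micali 1984, §3.3 Lemma 1] [cite: BlumMicali1984, §3.3 Lemma 1 (proof)] -/
@[simp] theorem eval_bmRoundC (p g m k : ℕ) (blk : Fin m → Fin (k + 1) → Bool) (e : ℕ) :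
    eval O (bmRoundC p g m k blk e) = bmRoundE p g (bmSelect p g (bmBitOracle O p g) m k blk) e := by
  simp only [bmRoundC, bmRoundE, eval_bind, eval_pure, eval_bmSelectC]

/-- A round asks `2m` queries. [Blum–Micali 1984, §3.3 Lemma 1] [cite: BlumMicali1984, §3.3 Lemma 1 (proof)] -/
@[simp] theorem queryCount_bmRoundC (p g m k : ℕ) (blk : Fin m → Fin (k + 1) → Bool) (e : ℕ) :
    queryCount O (bmRoundC p g m k blk e) = 2 * m := by
  simp only [bmRoundC, queryCount_bind, queryCount_bmSelectC, queryCount_pure, add_zero]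

/-- For rounds `t < ℓ` the round-`t` blocks give the selector family `bmSelFamily`. [folklore] -/
theorem bmSelect_bmBlk {p g : ℕ} (β : ℕ → Bool) {ℓ m k : ℕ}
    (ω : Fin ℓ → Fin m → Fin (k + 1) → Bool) {t : ℕ} (ht : t < ℓ) :
    bmSelect p g β m k (bmBlk ℓ m k ω t) = bmSelFamily p g β ℓ m k ω t := by
  funext e
  simp only [bmBlk, bmSelFamily, dif_pos ht]

/-- **The descent computes `bmIndexOutE`** for the selector family read off the coin table.
[Blum–Micali 1984, §3.3 Lemma 1] [cite: BlumMicali1984, §3.3 Lemma 1] -/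
theorem eval_bmDescentC (p g ℓ m k : ℕ) (ω : Fin ℓ → Fin m → Fin (k + 1) → Bool) (w : ℕ) :
    eval O (bmDescentC p g ℓ m k ω w) =
      bmIndexOutE p g (bmSelFamily p g (bmBitOracle O p g) ℓ m k ω) w ℓ := by
  set sel := bmSelFamily p g (bmBitOracle O p g) ℓ m k ω with hsel
  have key : ∀ n, n ≤ ℓ →
      (fun s => eval O (bmDescentStepC p g ℓ m k ω s))^[n] (0, w, 0) =
        (n, bmElemE p g sel w n, bmIndexOutE p g sel w n) := by
    intro n
    induction n with
    | zero => intro _; rfl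
    | succ n ih =>
      intro hn
      rw [Function.iterate_succ_apply', ih (Nat.le_of_succ_le hn)]
      simp only [bmDescentStepC, eval_bind, eval_pure, eval_bmRoundC,
        bmSelect_bmBlk _ ω (Nat.lt_of_succ_le hn)]
      rfl
  simp only [bmDescentC, eval_bind, eval_pure, eval_iterM]
  rw [key ℓ le_rfl]

/-- The descent asks at most `ℓ · 2m` queries. [Blum–Micali 1984, §3.3 Lemma 1] [cite: BlumMicali1984, §3.3 Lemma 1] -/
theorem queryCount_bmDescentC_le (p g ℓ m k : ℕ) (ω : Fin ℓ → Fin m → Fin (k + 1) → Bool)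
    (w : ℕ) : queryCount O (bmDescentC p g ℓ m k ω w) ≤ ℓ * (2 * m) := by
  simp only [bmDescentC, queryCount_bind, queryCount_pure, add_zero]
  refine queryCount_iterM_le O _ (fun s => ?_) ℓ _
  simp only [bmDescentStepC, queryCount_bind, queryCount_bmRoundC, queryCount_pure, add_zero, le_rfl]

/-- The candidate of guess `i`, in closed form. [Blum–Micali 1984, §3.3, proof of Theorem 3] [cite: BlumMicali1984, Theorem 3 (proof)] -/
theorem eval_bmCandidateC (Q : Polynomial ℕ) (p g y : ℕ) (r : List Bool) (i : ℕ) :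
    eval O (bmCandidateC Q p g y r i) =
      bmIndexOutE p g (bmSelFamily p g (bmBitOracle O p g) p.size (bmM Q p) (bmK Q p)
        (bmBlocks r p.size (bmM Q p) (bmK Q p) i)) (y * (g ^ (p - 2)) ^ (i * bmSeg Q p) % p)
        p.size + i * bmSeg Q p := by
  simp only [bmCandidateC, eval_bind, eval_pure, eval_bmDescentC]

/-- A guess asks at most `ℓ · 2m` queries. [folklore] -/
theorem queryCount_bmCandidateC_le (Q : Polynomial ℕ) (p g y : ℕ) (r : List Bool) (i : ℕ) :
    queryCount O (bmCandidateC Q p g y r i) ≤ p.size * (2 * bmM Q p) := by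
  simp only [bmCandidateC, queryCount_bind, queryCount_pure, add_zero]
  exact queryCount_bmDescentC_le O _ _ _ _ _ _ _

/-- The candidates computed by `bmMainC`, in closed form. [Blum–Micali 1984, §3.3, proof of
Theorem 3] [cite: BlumMicali1984, Theorem 3 (proof)] -/
def bmCandidates (Q : Polynomial ℕ) (β : ℕ → Bool) (p g y : ℕ) (r : List Bool) : List ℕ :=
  (List.range (bmGuesses Q p)).map fun i =>
    bmIndexOutE p g (bmSelFamily p g β p.size (bmM Q p) (bmK Q p)
      (bmBlocks r p.size (bmM Q p) (bmK Q p) i)) (y * (g ^ (p - 2)) ^ (i * bmSeg Q p) % p)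
      p.size + i * bmSeg Q p

/-- **What the reduction outputs**, for every oracle: `bmOutput` of the closed-form candidates.
[Blum–Micali 1984, §3.3, proof of Theorem 3] [cite: BlumMicali1984, Theorem 3 (proof)] -/
theorem eval_bmMainC (Q : Polynomial ℕ) (p g y : ℕ) (r : List Bool) :
    eval O (bmMainC Q p g y r) =
      if bmGuard p g y then bmOutput p g y (bmCandidates Q (bmBitOracle O p g) p g y r)
      else [] := by
  unfold bmMainC
  split
  · simp only [eval_bind, eval_pure, eval_forEach, eval_bmCandidateC, bmCandidates]
  · simp only [eval_pure]

/-- The reduction asks at most `2q · ℓ · 2m ≤ 48 ℓ² q³` queries. [Blum–Micali 1984, §3.3,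
proof of Theorem 3 (running time)] [cite: BlumMicali1984, Theorem 3 (proof)] -/
theorem queryCount_bmMainC_le (Q : Polynomial ℕ) (p g y : ℕ) (r : List Bool) :
    queryCount O (bmMainC Q p g y r) ≤ 48 * p.size ^ 2 * bmQ Q p ^ 3 := by
  unfold bmMainC
  split
  · simp only [queryCount_bind, queryCount_pure, add_zero]
    refine (queryCount_forEach_le O _ _ fun i _ => queryCount_bmCandidateC_le O Q p g y r i).trans ?_
    rw [List.length_range]
    unfold bmGuesses bmM
    exact le_of_eq (by ring)
  · simp only [queryCount_pure]
    exact Nat.zero_le _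

/-- On a well-formed machine input the parse recovers `(p, g, y, r)`. [folklore] -/
theorem bmComp_boolPair (Q : Polynomial ℕ) (p g y : ℕ) (r : List Bool) :
    bmComp Q (boolPair (encodeDLogInstance p g y) r) = bmMainC Q p g y r := by
  simp only [bmComp, encodeDLogInstance, Encoding.pairBool, boolUnpair_boolPair]
  simp [encodingNatBool]

end Eval

/-! ### Correctness on the good coin tables -/

section Correct

variable {p g y : ℕ}

/-- If some candidate `c` satisfies `g^c ≡ y`, the output is (the encoding of) a discrete
logarithm of `y`. [Blum–Micali 1984, §3.3, proof of Theorem 3, Step 3] [cite: BlumMicali1984, Theorem 3 (proof)] -/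
theorem bmOutput_mem (hinst : IsDLogInstance p g y) {cands : List ℕ}
    (h : ∃ c ∈ cands, g ^ c % p = y % p) :
    ∃ a ∈ dlogSolutions p g y, bmOutput p g y cands = encodeNat a := by
  obtain ⟨hp, hg0, hgp, hord, hy0, hyp⟩ := hinst
  have hsome : (cands.find? fun c => decide (g ^ c % p = y % p)).isSome := by
    rw [List.find?_isSome]
    obtain ⟨c, hc, hcy⟩ := h
    exact ⟨c, hc, decide_eq_true hcy⟩
  obtain ⟨c, hc⟩ := Option.isSome_iff_exists.1 hsome
  have hcy : g ^ c % p = y % p := by simpa using List.find?_some hc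
  refine ⟨c % (p - 1), ?_, by simp [bmOutput, hc]⟩
  rw [mem_dlogSolutions]
  refine ⟨Nat.mod_lt _ (by have := hp.two_le; omega), ?_⟩
  -- `g^(c mod (p-1)) ≡ g^c ≡ y`
  haveI : Fact p.Prime := ⟨hp⟩
  have h1 : (g : ZMod p) ^ (c % (p - 1)) = (g : ZMod p) ^ c := by
    rw [← hord, pow_mod_orderOf]
  have h2 : ((g ^ (c % (p - 1)) : ℕ) : ZMod p) = ((y : ℕ) : ZMod p) := by
    push_cast
    rw [h1]
    have := (ZMod.natCast_eq_natCast_iff' (g ^ c) y p).2 hcy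
    push_cast at this
    exact this
  exact (ZMod.natCast_eq_natCast_iff _ _ _).1 h2

/-- For `p = 2` the first candidate is verified (`g = y = 1`). [folklore] -/
theorem exists_candidate_two (hinst : IsDLogInstance p g y) (hp2 : p = 2) {cands : List ℕ}
    (hne : cands ≠ []) : ∃ c ∈ cands, g ^ c % p = y % p := by
  obtain ⟨hp, hg0, hgp, hord, hy0, hyp⟩ := hinst
  subst hp2
  have hg1 : g = 1 := by omega
  have hy1 : y = 1 := by omega
  subst hg1 hy1
  obtain ⟨c, l, rfl⟩ := List.exists_cons_of_ne_nil hne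
  exact ⟨c, by simp, by simp⟩

/-- **The right guess yields the index (off the bad coin tables).** For an odd prime `p`, an
instance `(p, g, y)` with `index_g(y) = a`, the guess `i₀ = a / S` starts the descent at
`w = y g^{-i₀ S}`, of index `a mod S` (in the initial segment); if the coin table of that guess is
not bad, the descent returns `a mod S` and the candidate is `a`. [Blum–Micali 1984, §3.3, proof
of Theorem 3 with Lemma 1] [cite: BlumMicali1984, Theorem 3 (proof)] -/
theorem candidate_eq_of_not_bad (Q : Polynomial ℕ) (β : ℕ → Bool) (hinst : IsDLogInstance p g y)
    (hp2 : p ≠ 2) {a : ℕ} (ha : a ∈ dlogSolutions p g y) (r : List Bool)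
    (hgood : ¬bmBad p g β p.size (bmM Q p) (bmK Q p) (a % bmSeg Q p)
      (bmBlocks r p.size (bmM Q p) (bmK Q p) (a / bmSeg Q p))) :
    bmIndexOutE p g (bmSelFamily p g β p.size (bmM Q p) (bmK Q p)
        (bmBlocks r p.size (bmM Q p) (bmK Q p) (a / bmSeg Q p)))
        (y * (g ^ (p - 2)) ^ (a / bmSeg Q p * bmSeg Q p) % p) p.size + a / bmSeg Q p * bmSeg Q p
      = a := by
  obtain ⟨hp, hg0, hgp, hord, hy0, hyp⟩ := hinst
  haveI : Fact p.Prime := ⟨hp⟩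
  have hgu : ¬p ∣ g := fun hd => absurd (Nat.le_of_dvd hg0 hd) (not_le.2 hgp)
  set S := bmSeg Q p with hS
  set i₀ := a / S with hi₀
  set a' := a % S with ha'
  set w := y * (g ^ (p - 2)) ^ (i₀ * S) % p with hw
  rw [mem_dlogSolutions] at ha
  obtain ⟨halt, hga⟩ := ha
  -- `w ≡ g^{a'}`: `y g^{(p-2) i₀ S} = g^{a' + i₀ S} g^{(p-2) i₀ S} = g^{a'} (g^{p-1})^{i₀ S}`
  have hgz : (g : ZMod p) ≠ 0 := by rwa [Ne, ZMod.natCast_eq_zero_iff]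
  have hgp1 : (g : ZMod p) ^ (p - 1) = 1 := by rw [← hord]; exact pow_orderOf_eq_one _
  have hwz : (w : ZMod p) = (g : ZMod p) ^ a' := by
    have hy : (y : ZMod p) = (g : ZMod p) ^ a := by
      have := (ZMod.natCast_eq_natCast_iff _ _ _).2 hga
      push_cast at this
      exact this.symm
    rw [hw, ZMod.natCast_mod, Nat.cast_mul, Nat.cast_pow, Nat.cast_pow, hy,
      show a = a' + i₀ * S by rw [ha', hi₀, add_comm]; exact (Nat.div_add_mod' a S).symm]
    rw [← pow_mul, pow_add, mul_assoc, ← pow_add,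
      show i₀ * S + (p - 2) * (i₀ * S) = (p - 1) * (i₀ * S) by
        have := hp.two_le; zify [this, Nat.one_le_of_lt hp.one_lt]; ring,
      pow_mul, hgp1, one_pow, mul_one]
  have hwu : ¬p ∣ w := by
    rw [← ZMod.natCast_eq_zero_iff, hwz]
    exact pow_ne_zero _ hgz
  have hw0 : 0 < w := Nat.pos_of_ne_zero fun h0 => hwu (h0 ▸ dvd_zero p)
  have hwp : w < p := Nat.mod_lt _ hp.pos
  have hinstw : IsDLogInstance p g w := ⟨hp, hg0, hgp, hord, hw0, hwp⟩
  have ha'sol : a' ∈ dlogSolutions p g w := by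
    rw [mem_dlogSolutions]
    refine ⟨lt_of_le_of_lt (Nat.mod_le _ _) halt, ?_⟩
    rw [← ZMod.natCast_eq_natCast_iff, Nat.cast_pow, ← hwz]
  have hinst1 : IsDLogInstance p g 1 := ⟨hp, hg0, hgp, hord, Nat.one_pos, hp.one_lt⟩
  have hdesc := bmIndexOutE_size_eq hinstw hp2 ha'sol
    (bmSelFamily p g β p.size (bmM Q p) (bmK Q p) (bmBlocks r p.size (bmM Q p) (bmK Q p) i₀))
    (fun i e he => not_dvd_bmSelFamily hp hgu β _ _ _ _ i he)
    (fun i hi => bmSelCorrectAt_of_not_bad hinst1 hp2 β hgood (by omega))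
  rw [hdesc, ha', hi₀]
  exact Nat.mod_add_div' a S

/-- **Correctness off the bad set.** If the coin table of the right guess is not bad (or
`p = 2`), the reduction outputs a discrete logarithm of `y`. [Blum–Micali 1984, §3.3, proof of
Theorem 3] [cite: BlumMicali1984, Theorem 3 (proof)] -/
theorem bmOutput_correct (Q : Polynomial ℕ) (hQ : ∀ n, 0 < Q.eval n) (β : ℕ → Bool)
    (hinst : IsDLogInstance p g y) {a : ℕ} (ha : a ∈ dlogSolutions p g y) (r : List Bool)
    (hgood : p = 2 ∨ ¬bmBad p g β p.size (bmM Q p) (bmK Q p) (a % bmSeg Q p)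
      (bmBlocks r p.size (bmM Q p) (bmK Q p) (a / bmSeg Q p))) :
    ∃ a₀ ∈ dlogSolutions p g y, bmOutput p g y (bmCandidates Q β p g y r) = encodeNat a₀ := by
  refine bmOutput_mem hinst ?_
  have hq : 1 ≤ bmQ Q p := hQ _
  rcases eq_or_ne p 2 with hp2 | hp2
  · refine exists_candidate_two hinst hp2 (List.ne_nil_of_length_pos ?_)
    rw [bmCandidates, List.length_map, List.length_range]
    unfold bmGuesses; omega
  · have hgood' := hgood.resolve_left hp2
    have halt : a < p - 1 := ((mem_dlogSolutions p g y a).1 ha).1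
    refine ⟨a, ?_, by rw [((mem_dlogSolutions p g y a).1 ha).2]⟩
    rw [bmCandidates, List.mem_map]
    refine ⟨a / bmSeg Q p, List.mem_range.2 (div_bmSeg_lt halt hq), ?_⟩
    exact candidate_eq_of_not_bad Q β hinst hp2 ha r hgood'

end Correct

/-! ### Uniform coins: the coin table of one guess is uniform -/

section Uniform

/-- **Sub-tables of a uniform bit table are uniform.** For an injective position map
`ι : A → Fin n`, reading the bits at positions `ι` pushes the uniform distribution on
`Fin n → Bool` to the uniform one on `A → Bool`: `#{f | P (f ∘ ι)} · 2^{|A|} = #{h | P h} · 2^n`.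
(Marginals of independent fair coins.) [folklore] -/
private theorem card_filter_comp_mul {A : Type} [Fintype A] [DecidableEq A] {n : ℕ} (ι : A → Fin n)
    (hι : Function.Injective ι) (P : (A → Bool) → Prop) [DecidablePred P] :
    (univ.filter fun f : Fin n → Bool => P (f ∘ ι)).card * Fintype.card (A → Bool) =
      (univ.filter P).card * Fintype.card (Fin n → Bool) := by
  classical
  let s : Set (Fin n) := Set.range ι
  let e₁ : Fin n ≃ s ⊕ (sᶜ : Set (Fin n)) := (Equiv.Set.sumCompl s).symm
  let e₂ : s ≃ A := (Equiv.ofInjective ι hι).symm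
  let e : (Fin n → Bool) ≃ (A → Bool) × ((sᶜ : Set (Fin n)) → Bool) :=
    ((Equiv.arrowCongr e₁ (Equiv.refl Bool)).trans
      (Equiv.sumArrowEquivProdArrow _ _ Bool)).trans
      (Equiv.prodCongr (Equiv.arrowCongr e₂ (Equiv.refl Bool)) (Equiv.refl _))
  have he : ∀ f : Fin n → Bool, (e f).1 = f ∘ ι := fun f => rfl
  have h1 : (univ.filter fun f : Fin n → Bool => P (f ∘ ι)) =
      univ.filter fun f => P (e f).1 := Finset.filter_congr fun f _ => by rw [he]
  have h2 := card_filter_fst_equiv e P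
  have h3 : Fintype.card (Fin n → Bool) =
      Fintype.card (A → Bool) * Fintype.card ((sᶜ : Set (Fin n)) → Bool) := by
    rw [← Fintype.card_prod]; exact Fintype.card_congr e
  rw [h1, h2, h3]
  ring

/-- Uncurrying a coin table. [folklore] -/
def bmTableEquiv (ℓ m k : ℕ) :
    (Fin ℓ → Fin m → Fin (k + 1) → Bool) ≃ (Fin ℓ × Fin m × Fin (k + 1) → Bool) :=
  ((Equiv.refl (Fin ℓ)).arrowCongr (Equiv.curry (Fin m) (Fin (k + 1)) Bool).symm).trans
    (Equiv.curry (Fin ℓ) (Fin m × Fin (k + 1)) Bool).symm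

/-- **The coin table of one guess is uniform**: for a guess `i` whose positions fit into the
coin vector (`(i+1) ℓ m (k+1) ≤ n`), the number of coin vectors whose guess-`i` table satisfies
`P`, times the number of tables, is `#{ω | P ω} · 2^n`. [folklore] -/
theorem card_filter_bmBlocks_mul {n ℓ m k i : ℕ} (hn : (i + 1) * ℓ * m * (k + 1) ≤ n)
    (P : (Fin ℓ → Fin m → Fin (k + 1) → Bool) → Prop) [DecidablePred P] :
    (univ.filter fun v : List.Vector Bool n => P (bmBlocks v.toList ℓ m k i)).card *
        Fintype.card (Fin ℓ → Fin m → Fin (k + 1) → Bool) =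
      (univ.filter P).card * 2 ^ n := by
  classical
  -- positions
  let ι : Fin ℓ × Fin m × Fin (k + 1) → Fin n := fun tjs =>
    ⟨bmCoinIdx ℓ m k i tjs.1 tjs.2.1 tjs.2.2,
      lt_of_lt_of_le (bmCoinIdx_lt tjs.1.2 tjs.2.1.2 tjs.2.2.2) hn⟩
  have hι : Function.Injective ι := by
    intro x x' h
    exact bmCoinIdx_injective ℓ m k i (by simpa [ι] using congrArg Fin.val h)
  let T := bmTableEquiv ℓ m k
  -- the predicate on uncurried tables
  have key := card_filter_comp_mul ι hι (fun h => P (T.symm h))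
  -- vectors ↔ functions
  have hblocks : ∀ v : List.Vector Bool n,
      bmBlocks v.toList ℓ m k i = T.symm ((Equiv.vectorEquivFin Bool n v) ∘ ι) := by
    intro v
    funext t j s
    have hlt : bmCoinIdx ℓ m k i t j s < v.toList.length := by
      rw [List.Vector.toList_length]
      exact lt_of_lt_of_le (bmCoinIdx_lt t.2 j.2 s.2) hn
    simp only [bmBlocks, T, bmTableEquiv, ι, Equiv.vectorEquivFin]
    rw [List.getD_eq_getElem _ _ hlt]
    simp [Equiv.curry, List.Vector.get_eq_get_toList]
  have h1 : (univ.filter fun v : List.Vector Bool n => P (bmBlocks v.toList ℓ m k i)).card =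
      (univ.filter fun f : Fin n → Bool => P (T.symm (f ∘ ι))).card := by
    refine Finset.card_equiv (Equiv.vectorEquivFin Bool n) fun v => ?_
    simp only [mem_filter, mem_univ, true_and, hblocks]
  have h2 : (univ.filter fun h : Fin ℓ × Fin m × Fin (k + 1) → Bool => P (T.symm h)).card =
      (univ.filter P).card := by
    refine Finset.card_equiv T.symm fun h => ?_
    simp only [mem_filter, mem_univ, true_and]
  have h3 : Fintype.card (Fin ℓ × Fin m × Fin (k + 1) → Bool) =
      Fintype.card (Fin ℓ → Fin m → Fin (k + 1) → Bool) := Fintype.card_congr T.symm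
  have h4 : Fintype.card (Fin n → Bool) = 2 ^ n := by simp
  rw [h1, ← h3, key, h2, h4]

end Uniform

/-! ### The success probability -/

section Success

/-- The parameters of Theorem 3's analysis are met: `12 ℓ q² ≤ m` (trivially), the block width,
and the coin budget covers the positions of every guess `i < 2q`. [folklore] -/
theorem bmCoins_enough (Q : Polynomial ℕ) {p : ℕ} (x : List Bool) (hx : p.size ≤ x.length)
    {i : ℕ} (hi : i < bmGuesses Q p) :
    (i + 1) * p.size * bmM Q p * (bmK Q p + 1) ≤ (bmCoins Q).eval x.length := by
  have hq : bmQ Q p ≤ Q.eval x.length := natPoly_eval_mono Q hx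
  have hk : bmK Q p + 1 ≤ x.length + Q.eval x.length + 2 := by
    unfold bmK
    have h1 : (bmQ Q p + 1).size ≤ bmQ Q p + 1 := Nat.size_le.2 Nat.lt_two_pow_self
    omega
  have hi' : i + 1 ≤ 2 * Q.eval x.length := by unfold bmGuesses at hi; omega
  simp only [bmCoins, Polynomial.eval_mul, Polynomial.eval_add, Polynomial.eval_pow,
    Polynomial.eval_X, Polynomial.eval_ofNat]
  unfold bmM
  calc (i + 1) * p.size * (12 * p.size * bmQ Q p ^ 2) * (bmK Q p + 1)
      ≤ (2 * Q.eval x.length) * x.length * (12 * x.length * Q.eval x.length ^ 2) *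
          (x.length + Q.eval x.length + 2) := by gcongr
    _ = 24 * x.length ^ 2 * Q.eval x.length ^ 3 * (x.length + Q.eval x.length + 2) := by ring

/-- The round budget exceeds the number of queries. [folklore] -/
theorem queryCount_lt_bmFuel (Q : Polynomial ℕ) (O : Oracle) {p g y : ℕ} (x : List Bool)
    (hx : p.size ≤ x.length) (r : List Bool) :
    queryCount O (bmMainC Q p g y r) < (bmFuel Q).eval x.length := by
  have hq : bmQ Q p ≤ Q.eval x.length := natPoly_eval_mono Q hx
  refine lt_of_le_of_lt (queryCount_bmMainC_le O Q p g y r) ?_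
  simp only [bmFuel, Polynomial.eval_mul, Polynomial.eval_add, Polynomial.eval_pow,
    Polynomial.eval_X, Polynomial.eval_ofNat, Polynomial.eval_one]
  have : 48 * p.size ^ 2 * bmQ Q p ^ 3 ≤ 48 * x.length ^ 2 * Q.eval x.length ^ 3 := by gcongr
  omega

/-- **Blum–Micali 1984, Theorem 3, for the concrete algorithm `bmOracleAlg`.** For every
polynomial `Q > 0`, oracle `O` and instance `(p, g, y)`: if `O` answers `B_{p,g}` correctly on
at least a `1/2 + 1/Q(|p|)` fraction of `ℤ_p^*`, then `bmOracleAlg Q` with oracle `O`, run with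
`bmCoins Q` uniform coins for `bmFuel Q` rounds, outputs the discrete logarithm of `y` with
probability at least `2/3`. [Blum–Micali 1984, §3.3, Theorem 3] [cite: BlumMicali1984, Theorem 3] -/
theorem bmOracleAlg_success (Q : Polynomial ℕ) (hQ : ∀ n, 0 < Q.eval n) (O : Oracle)
    {p g y : ℕ} (hinst : IsDLogInstance p g y)
    (hA : ((1 : ℝ) / 2 + 1 / ((Q.eval p.size : ℕ) : ℝ)) * ((p - 1 : ℕ) : ℝ) ≤
      (bmAgreement O p g : ℝ)) :
    (2 : ℝ) / 3 ≤ oracleDLogSuccessProb (bmOracleAlg Q) O (bmCoins Q) (bmFuel Q) p g y := by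
  classical
  have hinst' := hinst
  obtain ⟨hp, hg0, hgp, hord, hy0, hyp⟩ := hinst'
  set x := encodeDLogInstance p g y with hx
  set n := (bmCoins Q).eval x.length with hn
  set β := bmBitOracle O p g with hβ
  have hxlen : p.size ≤ x.length := size_le_length_encodeDLogInstance p g y
  have hq : 1 ≤ bmQ Q p := hQ _
  -- the discrete logarithm
  obtain ⟨a, ha, -⟩ := IsDLogInstance.existsUnique_mem_dlogSolutions hinst
  set i₀ := a / bmSeg Q p with hi₀
  set a' := a % bmSeg Q p with ha'
  have halt : a < p - 1 := ((mem_dlogSolutions p g y a).1 ha).1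
  have hi₀lt : i₀ < bmGuesses Q p := div_bmSeg_lt halt hq
  -- good coin vectors
  let Good : List.Vector Bool n → Prop := fun v =>
    p = 2 ∨ ¬bmBad p g β p.size (bmM Q p) (bmK Q p) a' (bmBlocks v.toList p.size (bmM Q p) (bmK Q p) i₀)
  let S : Set (Option (List Bool)) := {o | ∃ a₀ ∈ dlogSolutions p g y, o = some (encodeNat a₀)}
  -- (1) on good coins the run succeeds
  have hrun : ∀ v : List.Vector Bool n, Good v →
      (bmOracleAlg Q).run O ((bmFuel Q).eval x.length) (boolPair x v.toList) ∈ S := by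
    intro v hv
    have hrun := run_toOracleAlg (bmComp Q) O (boolPair x v.toList)
      (n := (bmFuel Q).eval x.length) (by
        rw [bmComp_boolPair]; exact queryCount_lt_bmFuel Q O x hxlen v.toList)
    change (toOracleAlg (bmComp Q)).run O _ _ ∈ S
    rw [hrun, bmComp_boolPair, eval_bmMainC]
    by_cases hG : bmGuard p g y = true
    · rw [if_pos hG]
      obtain ⟨a₀, ha₀, hout⟩ := bmOutput_correct Q hQ β hinst ha v.toList hv
      exact ⟨a₀, ha₀, by rw [hout]⟩
    · rw [if_neg hG]
      -- off the guard: `p = 2`, `g = y = 1`, and `0` is the discrete logarithm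
      have hp2 : p = 2 := by
        by_contra hne
        exact hG (bmGuard_of_isDLogInstance hinst hne)
      subst hp2
      have hg1 : g = 1 := by omega
      have hy1 : y = 1 := by omega
      subst hg1 hy1
      refine ⟨0, (mem_dlogSolutions 2 1 1 0).2 ⟨by norm_num, by simp [Nat.ModEq]⟩, ?_⟩
      have h0 : encodeNat 0 = [] := by decide
      rw [h0]
  -- (2) the good coins are at least two thirds
  have hgood : (2 : ℝ) / 3 * Fintype.card (List.Vector Bool n) ≤
      ((univ.filter Good).card : ℝ) := by
    have hcardV : (Fintype.card (List.Vector Bool n) : ℝ) = 2 ^ n := by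
      rw [card_vector, Fintype.card_bool]; push_cast; ring
    rcases eq_or_ne p 2 with hp2 | hp2
    · have : univ.filter Good = univ := Finset.filter_true_of_mem fun v _ => Or.inl hp2
      rw [this, card_univ]
      have : (0 : ℝ) ≤ Fintype.card (List.Vector Bool n) := by positivity
      linarith
    · -- complement = bad vectors, transferred to coin tables
      let Bad : List.Vector Bool n → Prop := fun v =>
        bmBad p g β p.size (bmM Q p) (bmK Q p) a' (bmBlocks v.toList p.size (bmM Q p) (bmK Q p) i₀)
      have hGB : univ.filter Good = univ.filter fun v => ¬Bad v :=
        Finset.filter_congr fun v _ => by simp [Good, Bad, hp2]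
      have hsum := Finset.card_filter_add_card_filter_not (s := (univ : Finset (List.Vector Bool n))) Bad
      rw [card_univ] at hsum
      -- the transfer
      have htr := card_filter_bmBlocks_mul (bmCoins_enough Q x hxlen hi₀lt)
        (bmBad p g β p.size (bmM Q p) (bmK Q p) a')
      change (univ.filter Bad).card * _ = _ at htr
      -- the bound on tables
      have hinst1 : IsDLogInstance p g 1 := ⟨hp, hg0, hgp, hord, Nat.one_pos, hp.one_lt⟩
      have hA' : (1 / 2 + 1 / (bmQ Q p : ℝ)) * ((p - 1 : ℕ) : ℝ) ≤ bmBitAgreement p g β := by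
        refine hA.trans ?_
        exact_mod_cast bmAgreement_le_bmBitAgreement O p g
      have htab := card_bmBad_le hinst1 hp2 β (ℓ := p.size) (m := bmM Q p) (k := bmK Q p)
        hq (Nat.size_pos.2 hp.pos) (two_mul_mod_bmSeg_mul_le a) bmK_spec le_rfl hA'
      -- combine: 3 #Bad · T ≤ T · 2^n with T = #tables > 0
      have hT : (0 : ℝ) < Fintype.card (Fin p.size → Fin (bmM Q p) → Fin (bmK Q p + 1) → Bool) :=
        by exact_mod_cast Fintype.card_pos
      have htr' : ((univ.filter Bad).card : ℝ) *
          Fintype.card (Fin p.size → Fin (bmM Q p) → Fin (bmK Q p + 1) → Bool) =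
          ((univ.filter (bmBad p g β p.size (bmM Q p) (bmK Q p) a')).card : ℝ) * 2 ^ n := by
        exact_mod_cast htr
      have hbad : 3 * ((univ.filter Bad).card : ℝ) ≤ 2 ^ n := by
        by_contra hcon
        rw [not_le] at hcon
        have := mul_lt_mul_of_pos_right hcon hT
        nlinarith
      have hsum' : ((univ.filter Bad).card : ℝ) + ((univ.filter fun v => ¬Bad v).card : ℝ) =
          Fintype.card (List.Vector Bool n) := by exact_mod_cast hsum
      rw [hGB]
      rw [hcardV] at hsum' ⊢
      linarith
  -- (3) measure
  unfold oracleDLogSuccessProb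
  rw [OracleAlg.randRun_eq_map, PMF.toOuterMeasure_map_apply]
  set μ := PMF.uniformOfFintype (List.Vector Bool ((bmCoins Q).eval (encodeDLogInstance p g y).length))
  have hsub : {v | Good v} ⊆
      (fun r => (bmOracleAlg Q).run O ((bmFuel Q).eval (encodeDLogInstance p g y).length)
        (boolPair (encodeDLogInstance p g y) r.toList)) ⁻¹' S := fun v hv => hrun v hv
  have hle : μ.toOuterMeasure {v | Good v} ≤ μ.toOuterMeasure _ :=
    μ.toOuterMeasure_mono (Set.inter_subset_left.trans hsub)
  have hne : μ.toOuterMeasure ((fun r => (bmOracleAlg Q).run O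
      ((bmFuel Q).eval (encodeDLogInstance p g y).length)
        (boolPair (encodeDLogInstance p g y) r.toList)) ⁻¹' S) ≠ ⊤ :=
    ne_top_of_le_ne_top ENNReal.one_ne_top
      (((μ.toOuterMeasure).mono (Set.subset_univ _)).trans_eq
        ((PMF.toOuterMeasure_apply_eq_one_iff _ _).2 (Set.subset_univ _)))
  refine le_trans ?_ (ENNReal.toReal_mono hne hle)
  rw [PMF.toOuterMeasure_uniformOfFintype_apply, ENNReal.toReal_div]
  simp only [ENNReal.toReal_natCast]
  rw [Fintype.card_of_subtype (univ.filter Good) (fun v => by simp)]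
  have hpos : (0 : ℝ) < Fintype.card (List.Vector Bool n) := by exact_mod_cast Fintype.card_pos
  rw [le_div_iff₀ hpos]
  exact hgood

end Success

/-! ### The named fact, modulo polynomial time of the step function -/

/-- **Named fact (the running-time half of Blum–Micali's Theorem 3): the reduction's step
function is polynomial-time.** For every polynomial `Q`, the transcript step function of
`bmOracleAlg Q` (input and answers so far ↦ next query or output, `OracleAlg.IsPolyTime`) is
computable in polynomial time in Mathlib's `TM2` model. Blum–Micali: "The following
probabilistic poly(|p|) time algorithm [with oracle MB] finds `index_g(y)`" — every step is
modular arithmetic on `|p|`-bit numbers (multiplication, exponentiation, Euler's criterion,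
square roots by [AMM] using the non-residue `g`), `Q(|p|)` is evaluated once, and the numbers of
guesses, rounds and votes are polynomial in `|p|`. Discharging it in Lean needs the closure of
`PolyTimeComputable` under composition (in the tree: `PolyTimeComputable.comp_holds`), pairing
and bounded iteration (`PolyTimeComputable.iterate`) applied to a program for `bmComp` — the
easy direction of Cobham's characterisation of polynomial time. [Blum–Micali 1984, §3.3,
proof of Theorem 3 (first sentence) with Lemma 1 ("in Probabilistic Poly Time"); Cobham 1965]
[cite: BlumMicali1984, Theorem 3 (proof)] -/
def bmOracleAlg_isPolyTime : Prop :=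
  ∀ Q : Polynomial ℕ, (bmOracleAlg Q).IsPolyTime (encodingList Bool)

/-- **Blum–Micali's Theorem 3 from the polynomial-time bound.** Given `bmOracleAlg_isPolyTime`,
the named fact `blumMicali_halfPredicate_dlog` holds, witnessed by `bmOracleAlg Q`, `bmCoins Q`,
`bmFuel Q` (`bmOracleAlg_success`). [Blum–Micali 1984, §3.3, Theorem 3] [cite: BlumMicali1984, Theorem 3] -/
theorem blumMicali_halfPredicate_dlog_of_isPolyTime (hpoly : bmOracleAlg_isPolyTime) :
    blumMicali_halfPredicate_dlog := by
  intro Q hQ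
  exact ⟨bmOracleAlg Q, bmCoins Q, bmFuel Q, hpoly Q, fun O p g y hinst hA =>
    bmOracleAlg_success Q hQ O hinst hA⟩

end Literature.Computability.Cryptography

end
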